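import Summits.Ventures.ResidMod.VerdictsFull
import Summits.Ventures.ResidMod.GoodReductionFromEuler
import HarnessLib

/-!
# Venture ResidMod — census-row verdicts in FINAL form: every local slot from Euler factors
# (kernel) plus named facts; only the residual-image slots remain binders

HONEST FRAMING. Interface file of a COMPUTATION cell (`pub-residmod`). NO surface is claimed modular;
nothing is computed here; ALL cited theorems are hypotheses (named facts of the tree, typed as printed,
NOT proved in the tree):
* `h832` — BCGP 2025 Thm. 8.3.2 (`bcgp_residuallyA5b_modular_abelianSurface`);
* `h111` — BCGP 2025 Thm. 1.1.1 (`bcgp2025_modThreeSurjective_modular_abelianSurface`);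
* `hB2` — BCGP 2025 Def. 9.1.2 remark (`bcgp2025_goodOrdinary_pDistinguished_abelianSurface`);
* `hDel` — Deligne 1969 / Howe 1995 ordinarity criterion (`deligne_hasGoodOrdinaryReductionAt_iff_not_dvd_middleCoeff`);
* `hNOS` — Serre–Tate 1968 Thm. 1, Néron–Ogg–Shafarevich (`AbelianVariety.hasGoodReductionAt_of_isUnramifiedAt`).
Per census row the KERNEL then checks: primes and parities (GAL5), `p ∤ b_p` (ORD), an integer Bézout
identity (DIST0), `(a₂,b₂) mod 3` (F2OK); and derives: the semistable clause / UNRAM2 / GOOD(p) from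
the Euler factors (`TateFrames`, `TorsionUnramified`, `GoodReductionFromEuler`). What stays a BINDER is
exactly the residual-image content: T-2 — the Weierstrass `2`-torsion frame `F` ("`A = Jac(X)`, rational
Weierstrass point") and `hcc` (one real root); T-L — the torsion frame of `ρb` and the SURJECTIVE verdict
`hsurj` of the cell's offline checker. The Euler factors themselves (`HasGoodEulerFactorAt`, exact
point counts ×2) are the engines' data.

* `modular_of_mod2RowNOS` (flag T-2), `modular_of_mod3RowNOS` (flag T-L): conclusion — every framed dual
  of every `V_p(A)` is `IsAutomorphicAE`.

References: [BoxerCalegariGeePilloni2025] arXiv:2502.20645 Thm. 1.1.1, Thm. 8.3.2, Def. 9.1.2, Lemma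
9.1.3, §8.1; [SerreTate1968] §1 Thm. 1; [Deligne1969OrdinaryAV] §2; [Howe1995OrdinaryAV] Def. 3.1;
[BrumerEtAl2019] (4.1.5).
-/

noncomputable section

namespace Summit.Ventures.ResidMod

open Equiv CategoryTheory IsDedekindDomain Field Polynomial Matrix
open scoped NumberField
open Literature.NumberTheory.GaloisRepresentations Literature.NumberTheory.Automorphic
open Literature.NumberTheory.Automorphic.Paramodular
open Literature.NumberTheory.DiophantineGeometry Literature.NumberTheory.FaltingsSerre
open Literature.AlgebraicGeometry.Motives (AbelianVariety HasGoodReductionAt)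

/-- **T-2 census row, final form.**  Binders: the Weierstrass `2`-torsion frame `F` and `hcc`; Euler
factors at odd `q₅` (`a,b` odd), `q₃` (`a` odd, `b` even) and at `2` (`b₂` odd, `L₂(T)` separable);
named facts `h832`, `hB2`, `hDel`, `hNOS`. Kernel-derived: GAL5, semistable clause, GOOD(2) (via `hNOS`),
ORD(2) (via `hDel`), `2`-distinguished (via `hB2` + bridge B3). Conclusion: every framed dual of every
`V_p(A)` is `IsAutomorphicAE`. CONDITIONAL on the four facts. [cite: BoxerCalegariGeePilloni2025, Thm. 8.3.2, Def. 9.1.2, §8.1] [cite: SerreTate1968, §1 Thm. 1] -/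
theorem modular_of_mod2RowNOS (h832 : bcgp_residuallyA5b_modular_abelianSurface)
    (hB2 : bcgp2025_goodOrdinary_pDistinguished_abelianSurface)
    (hDel : deligne_hasGoodOrdinaryReductionAt_iff_not_dvd_middleCoeff)
    (A : AbelianVariety ℚ) (hA : A.dim = 2)
    (hNOS : ∀ v : HeightOneSpectrum (𝓞 ℚ), A.hasGoodReductionAt_of_isUnramifiedAt v)
    (F : WeierstrassTwoTorsionFrame A)
    {q₅ : ℕ} (hq₅ : q₅.Prime) (hq₅2 : q₅ ≠ 2) {a₅ b₅ : ℤ}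
    (hL₅ : A.HasGoodEulerFactorAt q₅ ((lPolynomialOfSurface q₅ a₅ b₅).map (Int.castRingHom ℚ)))
    (ha₅ : Odd a₅) (hb₅ : Odd b₅)
    {q₃ : ℕ} (hq₃ : q₃.Prime) (hq₃2 : q₃ ≠ 2) {a₃ b₃ : ℤ}
    (hL₃ : A.HasGoodEulerFactorAt q₃ ((lPolynomialOfSurface q₃ a₃ b₃).map (Int.castRingHom ℚ)))
    (ha₃ : Odd a₃) (hb₃ : Even b₃)
    (hcc : ∀ c : absoluteGaloisGroup ℚ, IsComplexConjugation (algebraMap ℚ ℝ) c →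
      (F.perm c).support.card = 4)
    {a₂ b₂ : ℤ} (hL₂ : A.HasGoodEulerFactorAt 2 ((lPolynomialOfSurface 2 a₂ b₂).map (Int.castRingHom ℚ)))
    (hb₂ : ¬ (2 : ℤ) ∣ b₂) (hsep₂ : ((lPolynomialOfSurface 2 a₂ b₂).map (Int.castRingHom ℚ)).Separable) :
    ∀ (p : ℕ) [Fact p.Prime] (b : Module.Basis (Fin 4) ℚ_[p] (A.rationalTateModule p))
      (r : FramedGaloisRep ℚ (PadicAlgCl p) 4),
      (∀ g : absoluteGaloisGroup ℚ,
        (r g).val =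
          ((LinearMap.toMatrix b b (A.rationalTateRep p g⁻¹)).map
            (algebraMap ℚ_[p] (PadicAlgCl p))).transpose) →
      ∀ (hcpt : isCompact_glFiniteIntegralLevel 4 ℚ) (ι : PadicAlgCl p ≃+* ℂ),
        IsAutomorphicAE ι hcpt r :=
  modular_of_mod2Row h832 hB2 hDel A hA F hq₅ hq₅2 hL₅ ha₅ hb₅ hq₃ hq₃2 hL₃ ha₃ hb₃ hcc hL₂ hb₂ hsep₂
    (hasGoodReductionAt_of_hasGoodEulerFactorAt hA hNOS Nat.prime_two hL₂)

/-- **T-L census row, final form.**  Binders: the torsion frame (`ρb`, `hframe`) and the SURJECTIVE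
verdict `hsurj` (the fact's `J`-shape); Euler factors at `2` (`¬(b₂ ≡ 2 ∧ a₂ ≢ 0 mod 3)`) and `3`
(`3 ∤ b₃`, `L₃(T)` separable); named facts `h111`, `hDel`, `hNOS`. Kernel-derived: F2OK and UNRAM2
from `L₂`, GOOD(3) (via `hNOS`), ORD(3) (via `hDel`), (3b) (bridge B3). Conclusion: every framed dual of
every `V_p(A)` is `IsAutomorphicAE`. CONDITIONAL on the three facts. [cite: BoxerCalegariGeePilloni2025, Thm. 1.1.1, Lemma 9.1.3, Def. 9.1.2] [cite: SerreTate1968, §1 Thm. 1] -/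
theorem modular_of_mod3RowNOS (h111 : bcgp2025_modThreeSurjective_modular_abelianSurface)
    (hDel : deligne_hasGoodOrdinaryReductionAt_iff_not_dvd_middleCoeff)
    (A : AbelianVariety ℚ) (hA : A.dim = 2)
    (hNOS : ∀ v : HeightOneSpectrum (𝓞 ℚ), A.hasGoodReductionAt_of_isUnramifiedAt v)
    (ρb : FramedGaloisRep ℚ (ZMod 3) 4)
    (hframe : ∃ e₃ : A.geomTorsion (3 : ℕ) ≃+ (Fin 4 → ZMod 3),
      ∀ (g : absoluteGaloisGroup ℚ) (P : A.geomTorsion (3 : ℕ)),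
        e₃ (g • P) = ((ρb g⁻¹ : GL (Fin 4) (ZMod 3)) : Matrix (Fin 4) (Fin 4) (ZMod 3))ᵀ *ᵥ e₃ P)
    (hsurj : ∃ J : Matrix (Fin 4) (Fin 4) (ZMod 3), Jᵀ = -J ∧ IsUnit J.det ∧
      (∀ σ : absoluteGaloisGroup ℚ,
        (ρb σ).valᵀ * J * (ρb σ).val =
          (((modPCyclotomicCharacterZMod ℚ 3 σ)⁻¹ : (ZMod 3)ˣ) : ZMod 3) • J) ∧
      ∀ M : Matrix (Fin 4) (Fin 4) (ZMod 3),
        (∃ c : (ZMod 3)ˣ, Mᵀ * J * M = (c : ZMod 3) • J) →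
          ∃ σ : absoluteGaloisGroup ℚ, (ρb σ).val = M)
    {a₂ b₂ : ℤ} (hL2 : A.HasGoodEulerFactorAt 2 ((lPolynomialOfSurface 2 a₂ b₂).map (Int.castRingHom ℚ)))
    (hab : ¬ (((b₂ : ℤ) : ZMod 3) = 2 ∧ ((a₂ : ℤ) : ZMod 3) ≠ 0))
    {a₃ b₃ : ℤ} (hL3 : A.HasGoodEulerFactorAt 3 ((lPolynomialOfSurface 3 a₃ b₃).map (Int.castRingHom ℚ)))
    (hb₃ : ¬ (3 : ℤ) ∣ b₃) (hsepL : ((lPolynomialOfSurface 3 a₃ b₃).map (Int.castRingHom ℚ)).Separable) :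
    ∀ (p : ℕ) [Fact p.Prime] (b : Module.Basis (Fin 4) ℚ_[p] (A.rationalTateModule p))
      (r : FramedGaloisRep ℚ (PadicAlgCl p) 4),
      (∀ g : absoluteGaloisGroup ℚ,
        (r g).val =
          ((LinearMap.toMatrix b b (A.rationalTateRep p g⁻¹)).map
            (algebraMap ℚ_[p] (PadicAlgCl p))).transpose) →
      ∀ (hcpt : isCompact_glFiniteIntegralLevel 4 ℚ) (ι : PadicAlgCl p ≃+* ℂ),
        IsAutomorphicAE ι hcpt r :=
  modular_of_mod3Row' h111 hDel A hA ρb hframe hsurj hL2 hab hL3 hb₃ hsepL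
    (hasGoodReductionAt_of_hasGoodEulerFactorAt hA hNOS Nat.prime_three hL3)

end Summit.Ventures.ResidMod

end
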